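import Summits.Ventures.PackingBounds.ThreePointCert.C4Td10Proof
import Summits.Ventures.PackingBounds.Configurations.CodeThird4
import Summits.Ventures.PackingBounds.Configurations.SubspaceTransfer

/-!
# `A(4, arccos 1/3) = 14`: how many spheres can touch two touching spheres in `ℝ⁵`? Exactly `14`.

Framing: lottery ticket; floor = certified bounds/negative ranges. Venture `PackingBounds` (cell `pub-packcert`),
spherical-codes family, standard-angle column `s = 1/3` = Conway–Sloane *SPLAG* Ch. 9 Table 9.2 'How many spheres can
touch two spheres?' (bounds on `A(n, cos⁻¹ 1/3)`), whose `n = 4` entry reads `14–15` (lower bound credited to [Mac0];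
upper bound the LP value; Bachoc–Vallentin, ISIT 2007 / JAMS 2008 Table 5.2, `d = 10`: SDP bound `15`).

This file closes the entry IN THE KERNEL by combining two tree facts:
* the upper bound `ThreePointCert.C4Td10.code_dim4_third_le_14_sdp` (sdp seat gen 10): the Bachoc–Vallentin three-point
  semidefinite bound, degree `10`, Bachoc–Vallentin multiplier set (cell mode `sym2` + `B`), from the cell's exact rational
  certificate `sdp-n4-d10-s1-3-sym2-a10-hyb8dd-j170459` (bound value `14.999635…`), integer data checked by `decide` in the kernel;
* the lower bound `Config.CodeThird4.exists_code_third_14` (energy seat): `14` explicit unit vectors of `ℝ⁴` with pairwise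
  inner products `≤ 1/3`.
Hence **`A(4, arccos 1/3) = 14`** (`code_dim4_third_exact`, `code_dim4_third_isGreatest`), and the geometric reading that names
the table (`touching_two_spheres_dim5_le_14`): if unit spheres of `ℝ⁵` with pairwise disjoint interiors all touch two touching unit
spheres, there are at most `14` of them (centres `c` with `‖c - a‖ = ‖c - b‖ = 2`, `‖a - b‖ = 2`, `‖c - c'‖ ≥ 2`; the map
`c ↦ (c - (a+b)/2)/√3` lands in the unit sphere of the hyperplane `(a - b)ᗮ ≅ ℝ⁴` with pairwise inner products `≤ 1/3`).

## References
* J. H. Conway, N. J. A. Sloane, *Sphere Packings, Lattices and Groups*, 3rd ed., Springer 1999, Ch. 9 Table 9.2. [`ConwaySloane1999`]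
* C. Bachoc, F. Vallentin, New upper bounds for kissing numbers from semidefinite programming, J. Amer. Math. Soc. 21 (2008),
  Theorem 4.2 and Table 5.2. [`BachocVallentin2007`]
-/

noncomputable section

open Finset
open scoped RealInnerProductSpace

namespace Summit.Ventures.PackingBounds.SphericalCodes

/-- **`A(4, arccos 1/3) = 14`** (two-sided, in the kernel): there is a `14`-point code of unit vectors of `ℝ⁴` with pairwise
inner products `≤ 1/3`, and every such code has at most `14` points (the kernel-checked three-point bound
`ThreePointCert.C4Td10.code_dim4_third_le_14_sdp` [cite: BachocVallentin2007, Theorem 4.2]) — the `n = 4` entry `14–15` of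
SPLAG Table 9.2 is `14`. [cite: ConwaySloane1999, Ch. 9 Table 9.2] -/
theorem code_dim4_third_exact :
    (∃ C : Finset (EuclideanSpace ℝ (Fin 4)), C.card = 14 ∧ (∀ x ∈ C, ‖x‖ = 1) ∧
      (∀ x ∈ C, ∀ y ∈ C, x ≠ y → inner ℝ x y ≤ 1 / 3)) ∧
    ∀ C : Finset (EuclideanSpace ℝ (Fin 4)), (∀ x ∈ C, ‖x‖ = 1) →
      (∀ x ∈ C, ∀ y ∈ C, x ≠ y → inner ℝ x y ≤ 1 / 3) → C.card ≤ 14 :=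
  ⟨Config.CodeThird4.exists_code_third_14, ThreePointCert.C4Td10.code_dim4_third_le_14_sdp⟩

/-- **`A(4, arccos 1/3) = 14`** as a maximum: `14` is the greatest cardinality of a finite set of unit vectors of `ℝ⁴` with
pairwise inner products `≤ 1/3`. [cite: ConwaySloane1999, Ch. 9 Table 9.2] -/
theorem code_dim4_third_isGreatest :
    IsGreatest {N : ℕ | ∃ C : Finset (EuclideanSpace ℝ (Fin 4)), C.card = N ∧ (∀ x ∈ C, ‖x‖ = 1) ∧
      (∀ x ∈ C, ∀ y ∈ C, x ≠ y → inner ℝ x y ≤ 1 / 3)} 14 := by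
  refine ⟨code_dim4_third_exact.1, fun N hN => ?_⟩
  obtain ⟨C, hc, h1, h2⟩ := hN
  rw [← hc]; exact ThreePointCert.C4Td10.code_dim4_third_le_14_sdp C h1 h2

/-- Expansion helper: `‖w ∓ u/2‖² = 4`, `‖u‖² = 4` ⇒ `w ⊥ u` and `‖w‖² = 3`. -/
theorem inner_aux_touch {E : Type*} [NormedAddCommGroup E] [InnerProductSpace ℝ E] (w u : E)
    (huu : inner ℝ u u = (4 : ℝ)) (h1 : inner ℝ (w - (1 / 2 : ℝ) • u) (w - (1 / 2 : ℝ) • u) = (4 : ℝ))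
    (h2 : inner ℝ (w + (1 / 2 : ℝ) • u) (w + (1 / 2 : ℝ) • u) = (4 : ℝ)) :
    inner ℝ u w = 0 ∧ inner ℝ w w = (3 : ℝ) := by
  simp only [inner_sub_left, inner_sub_right, inner_add_left, inner_add_right, real_inner_smul_left,
    real_inner_smul_right] at h1 h2
  have hc := real_inner_comm u w
  rw [huu] at h1 h2
  constructor <;> linarith

/-- Expansion helper: `‖w‖² = ‖w'‖² = 3`, `‖w - w'‖² ≥ 4` ⇒ `⟪w, w'⟫ ≤ 1`. -/
theorem inner_aux_sep {E : Type*} [NormedAddCommGroup E] [InnerProductSpace ℝ E] (w w' : E)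
    (hw : inner ℝ w w = (3 : ℝ)) (hw' : inner ℝ w' w' = (3 : ℝ)) (hd : (4 : ℝ) ≤ inner ℝ (w - w') (w - w')) :
    inner ℝ w w' ≤ 1 := by
  simp only [inner_sub_left, inner_sub_right] at hd
  have hc := real_inner_comm w w'
  rw [hw, hw'] at hd
  linarith

/-- **Spheres touching two touching spheres in `ℝ⁵`.** If unit spheres centred at the points of `S ⊂ ℝ⁵` all touch
two touching unit spheres centred at `a` and `b` (`‖a - b‖ = 2`, `‖c - a‖ = ‖c - b‖ = 2`) and have pairwise disjoint
interiors (`‖c - c'‖ ≥ 2`), then there are at most `14` of them. [cite: ConwaySloane1999, Ch. 9 Table 9.2] -/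
theorem touching_two_spheres_dim5_le_14 (a b : EuclideanSpace ℝ (Fin 5)) (hab : ‖a - b‖ = 2)
    (S : Finset (EuclideanSpace ℝ (Fin 5)))
    (ha : ∀ c ∈ S, ‖c - a‖ = 2) (hb : ∀ c ∈ S, ‖c - b‖ = 2)
    (hS : ∀ c ∈ S, ∀ c' ∈ S, c ≠ c' → 2 ≤ ‖c - c'‖) :
    S.card ≤ 14 := by
  set u : EuclideanSpace ℝ (Fin 5) := a - b with hu
  set m : EuclideanSpace ℝ (Fin 5) := (1 / 2 : ℝ) • (a + b) with hm
  have hu0 : u ≠ 0 := by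
    intro h; rw [h, norm_zero] at hab; norm_num at hab
  have huu : inner ℝ u u = (4 : ℝ) := by
    rw [real_inner_self_eq_norm_sq, hab]; norm_num
  -- the normalised, centred points
  set f : EuclideanSpace ℝ (Fin 5) → EuclideanSpace ℝ (Fin 5) := fun c => (1 / Real.sqrt 3) • (c - m) with hf
  have key : ∀ c ∈ S, inner ℝ u (c - m) = 0 ∧ inner ℝ (c - m) (c - m) = (3 : ℝ) := by
    intro c hc
    have h1 : inner ℝ (c - a) (c - a) = (4 : ℝ) := by rw [real_inner_self_eq_norm_sq, ha c hc]; norm_num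
    have h2 : inner ℝ (c - b) (c - b) = (4 : ℝ) := by rw [real_inner_self_eq_norm_sq, hb c hc]; norm_num
    have e1 : c - a = (c - m) - (1 / 2 : ℝ) • u := by
      rw [hm, hu]; ext i; simp; ring
    have e2 : c - b = (c - m) + (1 / 2 : ℝ) • u := by
      rw [hm, hu]; ext i; simp; ring
    rw [e1] at h1; rw [e2] at h2
    exact inner_aux_touch (c - m) u huu h1 h2
  have hfn : ∀ c ∈ S, ‖f c‖ = 1 := by
    intro c hc
    have h3 : (0 : ℝ) < Real.sqrt 3 := Real.sqrt_pos.mpr (by norm_num)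
    have hn : ‖c - m‖ = Real.sqrt 3 := by
      have := (key c hc).2
      rw [real_inner_self_eq_norm_sq] at this
      rw [← Real.sqrt_sq (norm_nonneg (c - m)), this]
    rw [hf]; simp only []
    rw [norm_smul, hn, Real.norm_eq_abs, abs_of_pos (by positivity)]
    field_simp
  have hfo : ∀ x ∈ S.image f, inner ℝ u x = 0 := by
    intro x hx
    obtain ⟨c, hc, rfl⟩ := mem_image.mp hx
    rw [hf]; simp only []
    rw [real_inner_smul_right, (key c hc).1, mul_zero]
  have hfi : ∀ c ∈ S, ∀ c' ∈ S, c ≠ c' → inner ℝ (f c) (f c') ≤ 1 / 3 := by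
    intro c hc c' hc' hne
    have hd : (4 : ℝ) ≤ inner ℝ ((c - m) - (c' - m)) ((c - m) - (c' - m)) := by
      have e : (c - m) - (c' - m) = c - c' := by abel
      rw [e, real_inner_self_eq_norm_sq]
      have := hS c hc c' hc' hne
      nlinarith [norm_nonneg (c - c')]
    have hcc : inner ℝ (c - m) (c' - m) ≤ 1 := inner_aux_sep _ _ (key c hc).2 (key c' hc').2 hd
    rw [hf]; simp only []
    rw [real_inner_smul_left, real_inner_smul_right]
    have h3 : (1 / Real.sqrt 3) * (1 / Real.sqrt 3) = 1 / 3 := by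
      rw [div_mul_div_comm, one_mul, Real.mul_self_sqrt (by norm_num : (0 : ℝ) ≤ 3)]
    rw [← mul_assoc, h3]
    linarith
  have hinj : Set.InjOn f S := by
    intro c hc c' hc' he
    by_contra hne
    have h := hfi c hc c' hc' hne
    rw [he, real_inner_self_eq_norm_sq, hfn c' hc'] at h
    norm_num at h
  -- transfer to ℝ⁴
  obtain ⟨C', hcard, hno, hin, -⟩ := Config.exists_transfer_orthogonal_singleton (n := 4) u hu0 (S.image f) hfo
  have h1' : ∀ x ∈ C', ‖x‖ = 1 := by
    intro x hx
    obtain ⟨y, hy, he⟩ := hno x hx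
    obtain ⟨c, hc, rfl⟩ := mem_image.mp hy
    rw [he]; exact hfn c hc
  have h2' : ∀ x ∈ C', ∀ y ∈ C', x ≠ y → inner ℝ x y ≤ 1 / 3 := by
    intro x hx y hy hne
    obtain ⟨x0, hx0, y0, hy0, hne0, he⟩ := hin x hx y hy hne
    obtain ⟨c, hc, rfl⟩ := mem_image.mp hx0
    obtain ⟨c', hc', rfl⟩ := mem_image.mp hy0
    rw [he]
    exact hfi c hc c' hc' (fun h => hne0 (by rw [h]))
  have := ThreePointCert.C4Td10.code_dim4_third_le_14_sdp C' h1' h2'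
  rw [hcard, card_image_of_injOn hinj] at this
  exact this

/-- The coordinate embedding `ι : ℝ⁴ → ℝ⁵`, `x ↦ (0, x₀, x₁, x₂, x₃)`: it preserves inner products, commutes with
differences, and its image is orthogonal to `e₀`. -/
theorem exists_embed45 :
    ∃ ι : EuclideanSpace ℝ (Fin 4) → EuclideanSpace ℝ (Fin 5),
      (∀ x y, inner ℝ (ι x) (ι y) = inner ℝ x y) ∧ (∀ x y, ι x - ι y = ι (x - y)) ∧
        ∀ x, inner ℝ (EuclideanSpace.single (0 : Fin 5) (1 : ℝ)) (ι x) = 0 := by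
  have hco : ∀ x : EuclideanSpace ℝ (Fin 4),
      WithLp.ofLp ((WithLp.equiv 2 (Fin 5 → ℝ)).symm (Fin.cons (0 : ℝ) (WithLp.equiv 2 (Fin 4 → ℝ) x))) =
        Fin.cons (0 : ℝ) (WithLp.ofLp x) := fun x => by simp
  refine ⟨fun x => (WithLp.equiv 2 (Fin 5 → ℝ)).symm (Fin.cons (0 : ℝ) (WithLp.equiv 2 (Fin 4 → ℝ) x)),
    fun x y => ?_, fun x y => ?_, fun x => ?_⟩
  · simp only [EuclideanSpace.inner_eq_star_dotProduct, dotProduct, star_trivial, Pi.star_apply, hco]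
    rw [Fin.sum_univ_succ]
    simp only [Fin.cons_zero, Fin.cons_succ, mul_zero, zero_add]
  · apply (WithLp.ofLp_injective (p := 2)).eq_iff.mp
    rw [WithLp.ofLp_sub, hco, hco, hco, WithLp.ofLp_sub]
    ext j
    refine Fin.cases ?_ (fun i => ?_) j
    · simp
    · simp
  · rw [EuclideanSpace.inner_single_left]
    simp

/-- **Fourteen unit spheres of `ℝ⁵` touching two touching unit spheres** (centres `2e₀` and `0`), pairwise with disjoint
interiors: centres `e₀ + √3 · ι(x)` for the `14` code points `x` of `Config.CodeThird4`. -/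
theorem exists_touching_two_spheres_dim5_14 :
    ∃ a b : EuclideanSpace ℝ (Fin 5), ‖a - b‖ = 2 ∧ ∃ S : Finset (EuclideanSpace ℝ (Fin 5)), S.card = 14 ∧
      (∀ c ∈ S, ‖c - a‖ = 2) ∧ (∀ c ∈ S, ‖c - b‖ = 2) ∧ (∀ c ∈ S, ∀ c' ∈ S, c ≠ c' → 2 ≤ ‖c - c'‖) := by
  obtain ⟨C, hc, h1, h2⟩ := Config.CodeThird4.exists_code_third_14
  obtain ⟨embed45, inner_embed45, embed45_sub, inner_single_zero_embed45⟩ := exists_embed45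
  set e : EuclideanSpace ℝ (Fin 5) := EuclideanSpace.single (0 : Fin 5) (1 : ℝ) with he
  have he1 : ‖e‖ = 1 := by rw [he, PiLp.norm_single, norm_one]
  have hee : inner ℝ e e = (1 : ℝ) := by rw [real_inner_self_eq_norm_sq, he1]; norm_num
  set g : EuclideanSpace ℝ (Fin 4) → EuclideanSpace ℝ (Fin 5) := fun x => e + Real.sqrt 3 • embed45 x with hg
  have h3 : Real.sqrt 3 * Real.sqrt 3 = 3 := Real.mul_self_sqrt (by norm_num)
  have hio : ∀ x : EuclideanSpace ℝ (Fin 4), inner ℝ e (embed45 x) = 0 := fun x => inner_single_zero_embed45 x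
  -- squared distances
  have hga : ∀ x ∈ C, ‖g x - (2 : ℝ) • e‖ = 2 := by
    intro x hx
    have hx1 : inner ℝ (embed45 x) (embed45 x) = 1 := by rw [inner_embed45, real_inner_self_eq_norm_sq, h1 x hx]; norm_num
    have e1 : g x - (2 : ℝ) • e = Real.sqrt 3 • embed45 x - e := by rw [hg]; simp only []; module
    have hsq : inner ℝ (g x - (2 : ℝ) • e) (g x - (2 : ℝ) • e) = 4 := by
      rw [e1]
      simp only [inner_sub_left, inner_sub_right, real_inner_smul_left, real_inner_smul_right, hio, hee, hx1,
        real_inner_comm e (embed45 x)]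
      nlinarith [h3]
    rw [← Real.sqrt_sq (norm_nonneg _), ← real_inner_self_eq_norm_sq, hsq,
      show (4 : ℝ) = 2 ^ 2 by norm_num, Real.sqrt_sq (by norm_num : (0 : ℝ) ≤ 2)]
  have hgb : ∀ x ∈ C, ‖g x - 0‖ = 2 := by
    intro x hx
    have hx1 : inner ℝ (embed45 x) (embed45 x) = 1 := by rw [inner_embed45, real_inner_self_eq_norm_sq, h1 x hx]; norm_num
    have hsq : inner ℝ (g x) (g x) = 4 := by
      rw [hg]; simp only []
      simp only [inner_add_left, inner_add_right, real_inner_smul_left, real_inner_smul_right, hio, hee, hx1,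
        real_inner_comm e (embed45 x)]
      nlinarith [h3]
    rw [sub_zero, ← Real.sqrt_sq (norm_nonneg _), ← real_inner_self_eq_norm_sq, hsq,
      show (4 : ℝ) = 2 ^ 2 by norm_num, Real.sqrt_sq (by norm_num : (0 : ℝ) ≤ 2)]
  have hgg : ∀ x ∈ C, ∀ y ∈ C, x ≠ y → 2 ≤ ‖g x - g y‖ := by
    intro x hx y hy hxy
    have hx1 : inner ℝ x x = 1 := by rw [real_inner_self_eq_norm_sq, h1 x hx]; norm_num
    have hy1 : inner ℝ y y = 1 := by rw [real_inner_self_eq_norm_sq, h1 y hy]; norm_num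
    have hxy' := h2 x hx y hy hxy
    have e1 : g x - g y = Real.sqrt 3 • embed45 (x - y) := by
      rw [hg]; simp only []; rw [← embed45_sub]; module
    have hsq : 4 ≤ inner ℝ (g x - g y) (g x - g y) := by
      rw [e1, real_inner_smul_left, real_inner_smul_right, inner_embed45]
      simp only [inner_sub_left, inner_sub_right, hx1, hy1, real_inner_comm x y]
      nlinarith [h3]
    rw [real_inner_self_eq_norm_sq] at hsq
    nlinarith [norm_nonneg (g x - g y)]
  have hginj : Set.InjOn g C := by
    intro x hx y hy hexy
    by_contra hne
    have := hgg x hx y hy hne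
    rw [hexy, sub_self, norm_zero] at this; norm_num at this
  refine ⟨(2 : ℝ) • e, 0, ?_, C.image g, ?_, ?_, ?_, ?_⟩
  · rw [sub_zero, norm_smul, he1, Real.norm_eq_abs]; norm_num
  · rw [card_image_of_injOn hginj, hc]
  · intro c hc'; obtain ⟨x, hx, rfl⟩ := mem_image.mp hc'; exact hga x hx
  · intro c hc'; obtain ⟨x, hx, rfl⟩ := mem_image.mp hc'; exact hgb x hx
  · intro c hc' c' hc'' hne
    obtain ⟨x, hx, rfl⟩ := mem_image.mp hc'
    obtain ⟨y, hy, rfl⟩ := mem_image.mp hc''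
    exact hgg x hx y hy (fun h => hne (by rw [h]))


/-- **How many unit spheres of `ℝ⁵` can touch two touching unit spheres? Exactly `14`** (SPLAG Table 9.2, `n = 4`, settled in
the kernel): fourteen pairwise non-overlapping unit spheres touching both exist, and no configuration has more.
[cite: ConwaySloane1999, Ch. 9 Table 9.2] -/
theorem touching_two_spheres_dim5_exact :
    (∃ a b : EuclideanSpace ℝ (Fin 5), ‖a - b‖ = 2 ∧ ∃ S : Finset (EuclideanSpace ℝ (Fin 5)), S.card = 14 ∧
      (∀ c ∈ S, ‖c - a‖ = 2) ∧ (∀ c ∈ S, ‖c - b‖ = 2) ∧ (∀ c ∈ S, ∀ c' ∈ S, c ≠ c' → 2 ≤ ‖c - c'‖)) ∧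
    ∀ a b : EuclideanSpace ℝ (Fin 5), ‖a - b‖ = 2 → ∀ S : Finset (EuclideanSpace ℝ (Fin 5)),
      (∀ c ∈ S, ‖c - a‖ = 2) → (∀ c ∈ S, ‖c - b‖ = 2) → (∀ c ∈ S, ∀ c' ∈ S, c ≠ c' → 2 ≤ ‖c - c'‖) → S.card ≤ 14 :=
  ⟨exists_touching_two_spheres_dim5_14, fun a b hab S ha hb hS => touching_two_spheres_dim5_le_14 a b hab S ha hb hS⟩

end Summit.Ventures.PackingBounds.SphericalCodes

end
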